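import Literature.MathematicalPhysics.QuantumFieldTheory.Balaban1983to89.T3AlphaInputsAC
import Literature.MathematicalPhysics.QuantumFieldTheory.Balaban1983to89.B10Eq39CollarVolume
import Summits.QuantumFields.YangMills.Theorems.UnitScaleTiltProp7BlockDistanceWeights
import HarnessLib

/-!
# S1a · UV3-NODE §69.2 row δ4 — THE FOOTPRINT DIAMETER: `Witness.diam_foot`'s SHAPE `diam(foot X) ≤ M·(𝓛(X) + 1)` for the (α)-socket's activity system, from
# `EnlBounded` (print's `X̃`) and ONE inline row tying print's linear size `𝓛` to the geometry of the domain ([Balaban1985UV3] (24) p.262 «a linear size 𝓛(X) of a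
# localization X as the length of a shortest tree graph connecting the centers of big blocks in X …, if the big blocks are scaled to unit cubes» — `treeLen` is a FREE
# field of `AlphaDataT3`; the socket has no row binding it: UV3-NODE §69.2 δ4 «schema gap … `treeLen` is abstract data tied to nothing geometric»)

Cell `ym3-torus` (YM ladder rung R3 = continuum `SU(2)` Yang–Mills on the three-torus — a RUNG: NOT d = 4, NOT infinite volume, NOT a mass gap, NOT Clay).
Width seat «width 8» `ym3-torus-px8` (gen 23), FREE px helper on crux `stmt-QuantumFields-20520`, count-neutral, DEFINITION-FREE, default heartbeats; companion of
✓`…S1aAlphaLocalCover` (δ1).  THE ROW (inline, for the (α)-socket's interface pen — `LocDiam`): «every two sites of a listed level-`i` domain `Y` are within block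
pseudo-distance `CD·𝓛(Y)` at scale `i`» — `∀ Y ∈ Loc K k h i, ∀ x y ∈ Y, bdist (F.P K) M₁ i x y ≤ CD·treeLen K i Y` ((24): the centres of the big blocks of `X` are
joined by a tree of total length `𝓛(X)` in big-block units, so any two blocks of `X` are within `𝓛(X)` block units; `CD` absorbs the unit conventions, `M₁` among them).

WHAT (run `K`, level `k ≤ K`, term level `i ≤ k`; footprint of `⟨i, Y⟩` = the level-`k` sites `B^k`-under the enlargement `enl K i Y`, as in ✓`…S1aAlphaLocalCover`):
* §1 `tdist_enl_le` — two sites of the ENLARGEMENT of a listed domain are `≤ (2r + CD·𝓛(Y))·L^i + 18·M₁·L^i` fine steps apart (`EnlBounded` twice + the row + three block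
  diameters, ✓`tdist_le_blockDist_add'`).
* §2 ★★`diamFoot_le` — `Witness.diam_foot`'s SHAPE: for level-`k` sites `y, y′` under `enl K i Y`, `tdist y y′ ≤ (2r + 18M₁ + 3 + CD)·(𝓛(Y) + 1)` (level-`k` steps;
  ✓`Prop7BlockDistanceWeights.tdist_iterBlockOf_le`: the `k`-fold block map contracts by `L^k` up to `+d`; `L^i ≤ L^k`; `𝓛 ≥ 0` from `LocCover.1`) — the door's
  `M := 2r + 18M₁ + 3 + CD` (`M_j ≤ M₀`, `BalabanAdmissibleClassParams.diam`), uniform in `k`, `K`.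

WHAT THIS FILE IS NOT: no `Witness` is built; the row is a HYPOTHESIS (print (24) p.262 is its source); nothing of Bałaban's is proved; S1a(ᴴ), crux 20520 and `YM3TorusSU2` are
NOT proved; no registered stub is closed; the Yang–Mills mass gap is NOT proved.  Sorry-free, axioms standard.

References: T. Bałaban, CMP **102** (1985) 255–275 [Balaban1985UV3] ((24) p.262, p.263, (39) p.266).
-/

set_option autoImplicit false

noncomputable section

namespace Summit.QuantumFields.YangMills.Theorems.FluctuationComparisonRegPrIntLS1aAlphaFootDiam

open Literature.MathematicalPhysics.QuantumFieldTheory.Balaban1983to89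
open T3ContinuumYM3Torus T3UnitScaleTilt T3AlphaInputsAC
open B10Eq38TorusDomains (blockDist bdist)
open B10Eq39CollarVolume (tdist_le_blockDist_add')
open B3Taylor310LocalRemainder (tdist_triangle tdist_comm)
open B5Eq118OneStroke (iterBlockOf)
open Summit.QuantumFields.YangMills.Theorems.Prop7BlockDistanceWeights (tdist_iterBlockOf_le)

variable {F : T3Family} {γ : ℝ}

/-! ## §1 Two sites of an enlarged domain -/

/-- From a block pseudo-distance bound at scale `i` to a fine-step bound: `bdist M₁ i x y ≤ a ⟹ tdist x y ≤ a·L^i + 6·M₁·L^i` (the block distance is attained up to two block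
diameters, ✓`tdist_le_blockDist_add'`, `d = 3`). [cite: Balaban1985UV3, (39) p.266] -/
theorem tdist_le_of_bdist_le {K M₁ i : ℕ} (hM1 : 1 ≤ M₁) {x y : Site (F.P K) 0} {a : ℝ} (h : bdist (F.P K) M₁ i x y ≤ a) :
    (Site.tdist x y : ℝ) ≤ a * (F.L : ℝ) ^ i + 6 * M₁ * (F.L : ℝ) ^ i := by
  have hL0 : (0 : ℝ) < F.L := by have := F.hL.2; exact_mod_cast (by omega : 0 < F.L)
  have hs0 : 0 < M₁ * F.L ^ i := Nat.mul_pos (by omega) (pow_pos (by have := F.hL.2; omega) i)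
  have h1 : (blockDist (F.P K) 0 (M₁ * F.L ^ i) x y : ℝ) ≤ a * (F.L : ℝ) ^ i := by
    have h' : (blockDist (F.P K) 0 (M₁ * F.L ^ i) x y : ℝ) / (F.L : ℝ) ^ i ≤ a := h
    rwa [div_le_iff₀ (pow_pos hL0 i)] at h'
  have h2 : Site.tdist x y ≤ blockDist (F.P K) 0 (M₁ * F.L ^ i) x y + 2 * (3 * (M₁ * F.L ^ i)) := by
    have := tdist_le_blockDist_add' hs0 x y
    simpa using this
  have h2' : (Site.tdist x y : ℝ) ≤ (blockDist (F.P K) 0 (M₁ * F.L ^ i) x y : ℝ) + 2 * (3 * ((M₁ : ℝ) * (F.L : ℝ) ^ i)) := by exact_mod_cast h2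
  linarith

/-- **TWO SITES OF THE ENLARGEMENT `X̃` OF A LISTED DOMAIN** are `≤ (2r + CD·𝓛(Y))·L^i + 18·M₁·L^i` fine steps apart — `EnlBounded` (p.263 «X̃ = ∪_{□⊂X} □̃») at both ends and the
diameter row (24) in between. [cite: Balaban1985UV3, (24) p.262 and p.263] -/
theorem tdist_enl_le (D : AlphaDataT3 F γ) {M₁ : ℕ} {r CD : ℝ} (hEnl : EnlBounded D M₁ r) (hM1 : 1 ≤ M₁) {K k i : ℕ} {h : D.Hist K k}
    (hDiam : ∀ Y ∈ D.Loc K k h i, ∀ x ∈ Y, ∀ y ∈ Y, bdist (F.P K) M₁ i x y ≤ CD * D.treeLen K i Y)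
    {Y : Set (Site (F.P K) 0)} (hY : Y ∈ D.Loc K k h i) {x x' : Site (F.P K) 0} (hx : x ∈ D.enl K i Y) (hx' : x' ∈ D.enl K i Y) :
    (Site.tdist x x' : ℝ) ≤ (2 * r + CD * D.treeLen K i Y) * (F.L : ℝ) ^ i + 18 * M₁ * (F.L : ℝ) ^ i := by
  obtain ⟨y, hy, hxy⟩ := hEnl K i Y x hx
  obtain ⟨y', hy', hx'y'⟩ := hEnl K i Y x' hx'
  have h1 := tdist_le_of_bdist_le (K := K) hM1 hxy
  have h2 := tdist_le_of_bdist_le (K := K) hM1 (hDiam Y hY y hy y' hy')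
  have h3 := tdist_le_of_bdist_le (K := K) hM1 hx'y'
  have htri : Site.tdist x x' ≤ Site.tdist x y + (Site.tdist y y' + Site.tdist y' x') :=
    (tdist_triangle x y x').trans (Nat.add_le_add_left (tdist_triangle y y' x') _)
  have htri' : (Site.tdist x x' : ℝ) ≤ Site.tdist x y + (Site.tdist y y' + Site.tdist y' x') := by exact_mod_cast htri
  rw [tdist_comm x' y'] at h3
  linarith

/-! ## §2 The footprint diameter -/

/-- ★★ **`Witness.diam_foot`'s SHAPE FOR THE (α)-SOCKET's ACTIVITY SYSTEM**: run `K`, level `k ≤ K`, term level `i ≤ k`, history `h`; under `EnlBounded D M₁ r` (`r ≥ 0`,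
`1 ≤ M₁`), `𝓛 ≥ 0` (`LocCover.1`'s first clause, passed as `hlen`) and the INLINE diameter row (24) («`∀ x y ∈ Y, bdist M₁ i x y ≤ CD·𝓛(Y)`», `CD ≥ 0`): two level-`k` sites
under the enlargement of a listed level-`i` domain are `≤ (2r + 18M₁ + 3 + CD)·(𝓛(Y) + 1)` level-`k` steps apart — «The localization domain X is contained in a cube □ of the
size RM₁» (p.263) read at level `k`, the door's `M := 2r + 18M₁ + 3 + CD`. [cite: Balaban1985UV3, (24) p.262 and p.263] -/
theorem diamFoot_le (D : AlphaDataT3 F γ) {M₁ : ℕ} {r CD : ℝ} (hEnl : EnlBounded D M₁ r) (hr : 0 ≤ r) (hM1 : 1 ≤ M₁) (hCD : 0 ≤ CD)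
    (hlen : ∀ K i Y, 0 ≤ D.treeLen K i Y) {K k i : ℕ} (hk : k ≤ K) (hik : i ≤ k) {h : D.Hist K k}
    (hDiam : ∀ Y ∈ D.Loc K k h i, ∀ x ∈ Y, ∀ y ∈ Y, bdist (F.P K) M₁ i x y ≤ CD * D.treeLen K i Y)
    {Y : Set (Site (F.P K) 0)} (hY : Y ∈ D.Loc K k h i) {y y' : Site (F.P K) k}
    (hy : ∃ x ∈ D.enl K i Y, iterBlockOf k x = y) (hy' : ∃ x ∈ D.enl K i Y, iterBlockOf k x = y') :
    (Site.tdist y y' : ℝ) ≤ (2 * r + 18 * M₁ + 3 + CD) * (D.treeLen K i Y + 1) := by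
  obtain ⟨x, hx, rfl⟩ := hy
  obtain ⟨x', hx', rfl⟩ := hy'
  have hkK : k ≤ (F.P K).m + (F.P K).K := show k ≤ F.m + K by omega
  have hL1 : (1 : ℝ) ≤ F.L := by exact_mod_cast F.hL.2.le
  have hL0 : (0 : ℝ) < F.L := by linarith
  have hLk : (0 : ℝ) < (F.L : ℝ) ^ k := pow_pos hL0 k
  have hLik : (F.L : ℝ) ^ i ≤ (F.L : ℝ) ^ k := pow_le_pow_right₀ hL1 hik
  have hℓ := hlen K i Y
  -- the `k`-fold block map contracts by `L^k` up to `+d`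
  have hcon : Site.tdist (iterBlockOf k x) (iterBlockOf k x') ≤ Site.tdist x x' / F.L ^ k + 3 := by
    have := tdist_iterBlockOf_le hkK x x'
    simpa using this
  have hcon' : (Site.tdist (iterBlockOf k x) (iterBlockOf k x') : ℝ) ≤ (Site.tdist x x' : ℝ) / (F.L : ℝ) ^ k + 3 := by
    have hc : (Site.tdist (iterBlockOf k x) (iterBlockOf k x') : ℝ) ≤ ((Site.tdist x x' / F.L ^ k : ℕ) : ℝ) + 3 := by exact_mod_cast hcon
    have hq : ((Site.tdist x x' / F.L ^ k : ℕ) : ℝ) ≤ (Site.tdist x x' : ℝ) / (F.L : ℝ) ^ k := by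
      rw [le_div_iff₀ hLk]
      have : (Site.tdist x x' / F.L ^ k) * F.L ^ k ≤ Site.tdist x x' := Nat.div_mul_le_self _ _
      exact_mod_cast this
    linarith
  -- the fine bound of §1, divided by `L^k`
  have hfine := tdist_enl_le D hEnl hM1 hDiam hY hx hx'
  have hdiv : (Site.tdist x x' : ℝ) / (F.L : ℝ) ^ k ≤ 2 * r + CD * D.treeLen K i Y + 18 * M₁ := by
    rw [div_le_iff₀ hLk]
    have hA : 0 ≤ 2 * r + CD * D.treeLen K i Y + 18 * (M₁ : ℝ) := by positivity
    calc (Site.tdist x x' : ℝ) ≤ (2 * r + CD * D.treeLen K i Y) * (F.L : ℝ) ^ i + 18 * M₁ * (F.L : ℝ) ^ i := hfine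
      _ = (2 * r + CD * D.treeLen K i Y + 18 * M₁) * (F.L : ℝ) ^ i := by ring
      _ ≤ (2 * r + CD * D.treeLen K i Y + 18 * M₁) * (F.L : ℝ) ^ k := mul_le_mul_of_nonneg_left hLik hA
  have hM : (1 : ℝ) ≤ M₁ := by exact_mod_cast hM1
  calc (Site.tdist (iterBlockOf k x) (iterBlockOf k x') : ℝ) ≤ 2 * r + CD * D.treeLen K i Y + 18 * M₁ + 3 := by linarith
    _ ≤ (2 * r + 18 * M₁ + 3 + CD) * (D.treeLen K i Y + 1) := by nlinarith

end Summit.QuantumFields.YangMills.Theorems.FluctuationComparisonRegPrIntLS1aAlphaFootDiam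

end
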